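import Literature.NumberTheory.Transcendental.GridCubes
import Mathlib.RingTheory.MvPolynomial.Basic
import Mathlib.Algebra.Polynomial.Eval.Degree
import Mathlib.Data.Fintype.BigOperators
import HarnessLib

/-!
# Grid lemma, slicing tools: vertical lines, horizontal slices, face and column counts

Second file of the *grid lemma* (see `GridCubes.lean`, `HypersurfaceGridCount.lean`).  A polynomial in
`m + 1` real variables is viewed, through `MvPolynomial.finSuccEquiv`, as a one-variable polynomial
`G ∈ A[T]`, `A = ℝ[y_1, …, y_m]`, in the distinguished coordinate `t = x_0`; points are `Fin.cons t y`.
We record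

* the evaluation dictionary (`eval_cons_symm`, `eval_eval_C`, `hasDerivAt_eval_map`; evaluation
  at `Fin.cons t y` itself is Mathlib's `MvPolynomial.eval_eq_eval_mv_eval'`) and the degree
  bookkeeping (`totalDegree_eval_C_le`, `totalDegree_coeff_derivative_le`,
  `totalDegree_coeff_finSuccEquiv_le`);
* the **face count** `mul_card_faceZeros_le`: if every nonzero `Q ∈ A` of total degree `≤ d` meets
  at most `c · n^m / n` base cubes, then the pairs (level `j`, base cube `k'`) such that `G` vanishes
  somewhere on the bottom or on the top face of the cube `(j, k')` number at most
  `(4c + 2d) n^{m+1} / n` — the slices `G(a_j, ·)` are such `Q`'s except for at most `deg G ≤ d`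
  levels `a_j` (roots `T = a_j` of `G` in the domain `A`);
* the **column count** `card_columnRoots_le`: the pairs `(j, k')` such that `G` restricted to the
  vertical line through the corner of `k'` is nonzero and has a root strictly inside the `j`-th mesh
  interval number at most `d · n^m`.

## References

* M. Yoshinaga, *Periods and elementary real numbers*, arXiv:0805.0349 (2008), Lemma 29 (the rate
  of convergence of the cube count; the present slicing argument replaces the Minkowski-content
  estimate used there).
-/

noncomputable section

open Polynomial Finset

namespace Literature.NumberTheory.Transcendental

variable {m : ℕ}

/-! ### Evaluation dictionary -/

/-- Evaluating the inverse image of `G ∈ A[T]` at `Fin.cons t y` (via Mathlib's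
`MvPolynomial.eval_eq_eval_mv_eval'`). [folklore] -/
theorem eval_cons_symm (G : Polynomial (MvPolynomial (Fin m) ℝ)) (t : ℝ) (y : Fin m → ℝ) :
    MvPolynomial.eval (Fin.cons t y : Fin (m + 1) → ℝ) ((MvPolynomial.finSuccEquiv ℝ m).symm G) =
      (G.map (MvPolynomial.eval y)).eval t := by
  rw [MvPolynomial.eval_eq_eval_mv_eval', AlgEquiv.apply_symm_apply]

/-- The horizontal slice `G(a, ·) = G.eval (C a) ∈ A` evaluates at `y` to the value at `t = a` of the
vertical-line polynomial through `y`. [folklore] -/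
theorem eval_eval_C (G : Polynomial (MvPolynomial (Fin m) ℝ)) (a : ℝ) (y : Fin m → ℝ) :
    MvPolynomial.eval y (G.eval (MvPolynomial.C a)) = (G.map (MvPolynomial.eval y)).eval a := by
  rw [Polynomial.eval_map, ← Polynomial.eval₂_hom, MvPolynomial.eval_C]

/-- The vertical-line polynomial of the formal `T`-derivative is the derivative of the vertical-line
polynomial, so it computes the `t`-derivative of `t ↦ G(t, y)`. [folklore] -/
theorem hasDerivAt_eval_map (G : Polynomial (MvPolynomial (Fin m) ℝ)) (y : Fin m → ℝ) (t : ℝ) :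
    HasDerivAt (fun s => (G.map (MvPolynomial.eval y)).eval s)
      (((derivative G).map (MvPolynomial.eval y)).eval t) t := by
  rw [← Polynomial.derivative_map]
  exact (G.map (MvPolynomial.eval y)).hasDerivAt t

/-! ### Degree bookkeeping -/

/-- The horizontal slices `G.eval (C a)` have total degree at most the maximal total degree of the
coefficients of `G`. [folklore] -/
theorem totalDegree_eval_C_le (G : Polynomial (MvPolynomial (Fin m) ℝ)) {d : ℕ}
    (hG : ∀ i, (G.coeff i).totalDegree ≤ d) (a : ℝ) :
    (G.eval (MvPolynomial.C a)).totalDegree ≤ d := by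
  rw [Polynomial.eval_eq_sum_range]
  refine (MvPolynomial.totalDegree_finsetSum _ _).trans (Finset.sup_le fun i _ => ?_)
  calc (G.coeff i * MvPolynomial.C a ^ i).totalDegree
      ≤ (G.coeff i).totalDegree + (MvPolynomial.C a ^ i : MvPolynomial (Fin m) ℝ).totalDegree :=
        MvPolynomial.totalDegree_mul _ _
    _ ≤ d + 0 := by
        refine add_le_add (hG i) ?_
        rw [← MvPolynomial.C_pow, MvPolynomial.totalDegree_C]
    _ = d := add_zero d

/-- The coefficients of the formal derivative obey the same total-degree bound as those of `G`.
[folklore] -/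
theorem totalDegree_coeff_derivative_le (G : Polynomial (MvPolynomial (Fin m) ℝ)) {d : ℕ}
    (hG : ∀ i, (G.coeff i).totalDegree ≤ d) (i : ℕ) :
    ((derivative G).coeff i).totalDegree ≤ d := by
  rw [Polynomial.coeff_derivative]
  calc (G.coeff (i + 1) * ((i : MvPolynomial (Fin m) ℝ) + 1)).totalDegree
      ≤ (G.coeff (i + 1)).totalDegree + ((i : MvPolynomial (Fin m) ℝ) + 1).totalDegree :=
        MvPolynomial.totalDegree_mul _ _
    _ ≤ d + 0 := by
        refine add_le_add (hG (i + 1)) (le_of_eq ?_)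
        have : ((i : MvPolynomial (Fin m) ℝ) + 1) = MvPolynomial.C ((i : ℝ) + 1) := by simp
        rw [this, MvPolynomial.totalDegree_C]
    _ = d := add_zero d

/-- The coefficients of `finSuccEquiv P` have total degree at most that of `P`. [folklore] -/
theorem totalDegree_coeff_finSuccEquiv_le (P : MvPolynomial (Fin (m + 1)) ℝ) (i : ℕ) :
    ((MvPolynomial.finSuccEquiv ℝ m P).coeff i).totalDegree ≤ P.totalDegree := by
  by_cases hi : (MvPolynomial.finSuccEquiv ℝ m P).coeff i = 0
  · rw [hi, MvPolynomial.totalDegree_zero]; exact Nat.zero_le _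
  · exact le_trans (Nat.le_add_right _ _)
      (MvPolynomial.totalDegree_coeff_finSuccEquiv_add_le P i hi)

/-- The number of base cubes is `n ^ m`. [folklore] -/
theorem card_baseIndex (m n : ℕ) : Fintype.card (Fin m → Fin n) = n ^ m := by
  simp

/-! ### Face count -/

open Classical in
/-- **Face count.**  Assume every nonzero `Q ∈ ℝ[y_1,…,y_m]` of total degree `≤ d` vanishes on at
most `c n^m / n` cubes of any grid of mesh `h` in `ℝ^m` (the inductive hypothesis of the grid lemma).
Let `G ∈ A[T]` be nonzero with coefficients of total degree `≤ d` and `deg_T G ≤ d`.  Then the pairs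
(level `j < n`, base cube `k'`) such that `G` vanishes at a point of the bottom face `t = a_j` or of the
top face `t = a_{j+1}` of the cube `(j, k')` satisfy `n · # ≤ (4c + 2d) n^{m+1}`: each face lies in a
slice `G(a_j, ·)`, to which the hypothesis applies unless the slice vanishes identically, which happens
for at most `d` levels since `T - a_j` then divides `G`. [folklore] -/
theorem mul_card_faceZeros_le {c d : ℕ}
    (IH : ∀ Q : MvPolynomial (Fin m) ℝ, Q ≠ 0 → Q.totalDegree ≤ d →
      ∀ (n : ℕ) (y₀ : Fin m → ℝ) (h : ℝ), 0 < h →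
        n * (Finset.univ.filter fun k' : Fin m → Fin n =>
          ∃ y ∈ gridCube y₀ h (fun i => (k' i : ℕ)), MvPolynomial.eval y Q = 0).card ≤ c * n ^ m)
    (G : Polynomial (MvPolynomial (Fin m) ℝ)) (hG0 : G ≠ 0)
    (hG : ∀ i, (G.coeff i).totalDegree ≤ d) (hGd : G.natDegree ≤ d)
    (n : ℕ) (t₀ : ℝ) (y₀ : Fin m → ℝ) {h : ℝ} (hh : 0 < h) :
    n * (Finset.univ.filter fun p : Fin n × (Fin m → Fin n) =>
        ∃ y ∈ gridCube y₀ h (fun i => (p.2 i : ℕ)),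
          (G.map (MvPolynomial.eval y)).eval (t₀ + h * (p.1 : ℕ)) = 0 ∨
            (G.map (MvPolynomial.eval y)).eval (t₀ + h * ((p.1 : ℕ) + 1)) = 0).card ≤
      (4 * c + 2 * d) * n ^ (m + 1) := by
  rcases Nat.eq_zero_or_pos n with rfl | hn
  · simp
  -- levels and slice counts
  set a : ℕ → ℝ := fun j => t₀ + h * j with ha
  set N : ℕ → ℕ := fun j => (Finset.univ.filter fun k' : Fin m → Fin n =>
    ∃ y ∈ gridCube y₀ h (fun i => (k' i : ℕ)),
      MvPolynomial.eval y (G.eval (MvPolynomial.C (a j))) = 0).card with hN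
  -- (1) per-level bound
  have hlevel : ∀ j, n * N j ≤
      c * n ^ m + (if G.eval (MvPolynomial.C (a j)) = 0 then n ^ (m + 1) else 0) := by
    intro j
    split_ifs with h0
    · have h1 : N j ≤ n ^ m := by
        refine (card_filter_le _ _).trans ?_
        rw [card_univ, card_baseIndex]
      calc n * N j ≤ n * n ^ m := Nat.mul_le_mul_left _ h1
        _ = n ^ (m + 1) := by ring
        _ ≤ _ := le_add_self
    · exact (IH _ h0 (totalDegree_eval_C_le G hG _) n y₀ h hh).trans le_self_add
  -- (2) at most `d` vanishing slices among the levels `a 0, …, a n`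
  have hbad : ((range (n + 1)).filter fun j => G.eval (MvPolynomial.C (a j)) = 0).card ≤ d := by
    calc ((range (n + 1)).filter fun j => G.eval (MvPolynomial.C (a j)) = 0).card
        ≤ G.roots.toFinset.card := by
          refine card_le_card_of_injOn (fun j => MvPolynomial.C (a j)) (fun j hj => ?_)
            (fun j _ j' _ hjj' => ?_)
          · simp only [coe_filter, Finset.mem_range, Set.mem_setOf_eq] at hj
            rw [Finset.mem_coe, Multiset.mem_toFinset, Polynomial.mem_roots hG0]
            exact hj.2
          · have h1 : a j = a j' := MvPolynomial.C_injective _ _ hjj'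
            simp only [ha] at h1
            have h2 : (j : ℝ) = j' := by
              have := mul_left_cancel₀ hh.ne' (add_left_cancel h1)
              exact this
            exact_mod_cast h2
      _ ≤ G.roots.card := Multiset.toFinset_card_le _
      _ ≤ G.natDegree := G.card_roots'
      _ ≤ d := hGd
  -- (3) summing the per-level bounds over the levels `a 0, …, a n`
  have hsum : ∑ j ∈ range (n + 1), n * N j ≤ (n + 1) * (c * n ^ m) + d * n ^ (m + 1) := by
    calc ∑ j ∈ range (n + 1), n * N j
        ≤ ∑ j ∈ range (n + 1),
            (c * n ^ m + if G.eval (MvPolynomial.C (a j)) = 0 then n ^ (m + 1) else 0) :=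
          sum_le_sum fun j _ => hlevel j
      _ = (n + 1) * (c * n ^ m) +
            ∑ j ∈ range (n + 1), (if G.eval (MvPolynomial.C (a j)) = 0 then n ^ (m + 1) else 0) := by
          rw [sum_add_distrib, sum_const, card_range, smul_eq_mul]
      _ ≤ (n + 1) * (c * n ^ m) + d * n ^ (m + 1) := by
          refine add_le_add le_rfl ?_
          rw [← sum_filter, sum_const, smul_eq_mul]
          exact Nat.mul_le_mul_right _ hbad
  -- (4) the face set is covered, level by level, by the slice zero sets at `a j` and `a (j+1)`
  have hcard : (Finset.univ.filter fun p : Fin n × (Fin m → Fin n) =>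
        ∃ y ∈ gridCube y₀ h (fun i => (p.2 i : ℕ)),
          (G.map (MvPolynomial.eval y)).eval (t₀ + h * (p.1 : ℕ)) = 0 ∨
            (G.map (MvPolynomial.eval y)).eval (t₀ + h * ((p.1 : ℕ) + 1)) = 0).card ≤
      ∑ j : Fin n, (N j + N (j + 1)) := by
    rw [card_filter, Fintype.sum_prod_type]
    refine sum_le_sum fun j _ => ?_
    simp only [hN, card_filter, ← sum_add_distrib]
    refine sum_le_sum fun k' _ => ?_
    by_cases h1 : ∃ y ∈ gridCube y₀ h (fun i => (k' i : ℕ)),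
        (G.map (MvPolynomial.eval y)).eval (t₀ + h * (j : ℕ)) = 0 ∨
          (G.map (MvPolynomial.eval y)).eval (t₀ + h * ((j : ℕ) + 1)) = 0
    · rw [if_pos h1]
      obtain ⟨y, hy, hy0 | hy0⟩ := h1
      · have : ∃ y ∈ gridCube y₀ h (fun i => (k' i : ℕ)),
            MvPolynomial.eval y (G.eval (MvPolynomial.C (a j))) = 0 :=
          ⟨y, hy, by rw [eval_eval_C]; exact hy0⟩
        rw [if_pos this]
        exact le_self_add
      · have e : a ((j : ℕ) + 1) = t₀ + h * ((j : ℕ) + 1) := by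
          simp only [ha]; push_cast; ring
        have : ∃ y ∈ gridCube y₀ h (fun i => (k' i : ℕ)),
            MvPolynomial.eval y (G.eval (MvPolynomial.C (a ((j : ℕ) + 1)))) = 0 :=
          ⟨y, hy, by rw [eval_eval_C, e]; exact hy0⟩
        rw [if_pos this]
        exact le_add_self
    · rw [if_neg h1]
      exact Nat.zero_le _
  -- (5) shifting the levels
  have hshift : ∑ j : Fin n, (N j + N (j + 1)) ≤ 2 * ∑ j ∈ range (n + 1), N j := by
    rw [sum_add_distrib, two_mul]
    refine add_le_add ?_ ?_
    · rw [Fin.sum_univ_eq_sum_range (f := N)]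
      exact sum_le_sum_of_subset (range_subset_range.2 (Nat.le_succ n))
    · rw [Fin.sum_univ_eq_sum_range (f := fun j => N (j + 1)), sum_range_succ' N]
      exact Nat.le_add_right _ _
  -- (6) conclusion
  have h2n : n + 1 ≤ 2 * n := by omega
  calc n * (Finset.univ.filter fun p : Fin n × (Fin m → Fin n) =>
          ∃ y ∈ gridCube y₀ h (fun i => (p.2 i : ℕ)),
            (G.map (MvPolynomial.eval y)).eval (t₀ + h * (p.1 : ℕ)) = 0 ∨
              (G.map (MvPolynomial.eval y)).eval (t₀ + h * ((p.1 : ℕ) + 1)) = 0).card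
      ≤ n * ∑ j : Fin n, (N j + N (j + 1)) := Nat.mul_le_mul_left _ hcard
    _ ≤ n * (2 * ∑ j ∈ range (n + 1), N j) := Nat.mul_le_mul_left _ hshift
    _ = 2 * ∑ j ∈ range (n + 1), n * N j := by
        rw [← mul_assoc, mul_comm n 2, mul_assoc, Finset.mul_sum]
    _ ≤ 2 * ((n + 1) * (c * n ^ m) + d * n ^ (m + 1)) := Nat.mul_le_mul_left _ hsum
    _ ≤ 2 * ((2 * n) * (c * n ^ m) + d * n ^ (m + 1)) := by gcongr
    _ = (4 * c + 2 * d) * n ^ (m + 1) := by ring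

/-! ### Column count -/

open Classical in
/-- **Column count.**  For `G ∈ A[T]` with `deg_T G ≤ d`, the pairs (level `j < n`, base cube `k'`)
such that the vertical-line polynomial of `G` through the corner of `k'` is nonzero and has a root in
the open mesh interval `(a_j, a_{j+1})` number at most `d · n^m`: in each of the `n^m` columns the mesh
intervals are disjoint and the line polynomial has at most `d` roots. [folklore] -/
theorem card_columnRoots_le (G : Polynomial (MvPolynomial (Fin m) ℝ)) {d : ℕ}
    (hGd : G.natDegree ≤ d) (n : ℕ) (t₀ : ℝ) (y₀ : Fin m → ℝ) {h : ℝ} (hh : 0 < h) :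
    (Finset.univ.filter fun p : Fin n × (Fin m → Fin n) =>
        G.map (MvPolynomial.eval fun i => y₀ i + h * (p.2 i : ℕ)) ≠ 0 ∧
          ∃ t ∈ Set.Ioo (t₀ + h * (p.1 : ℕ)) (t₀ + h * ((p.1 : ℕ) + 1)),
            (G.map (MvPolynomial.eval fun i => y₀ i + h * (p.2 i : ℕ))).IsRoot t).card ≤
      d * n ^ m := by
  rw [card_filter, Fintype.sum_prod_type, sum_comm]
  calc ∑ k' : Fin m → Fin n, ∑ j : Fin n,
        (if G.map (MvPolynomial.eval fun i => y₀ i + h * (k' i : ℕ)) ≠ 0 ∧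
            ∃ t ∈ Set.Ioo (t₀ + h * (j : ℕ)) (t₀ + h * ((j : ℕ) + 1)),
              (G.map (MvPolynomial.eval fun i => y₀ i + h * (k' i : ℕ))).IsRoot t then 1 else 0)
      ≤ ∑ k' : Fin m → Fin n, d := by
        refine sum_le_sum fun k' _ => ?_
        set g := G.map (MvPolynomial.eval fun i => y₀ i + h * (k' i : ℕ)) with hg
        by_cases hg0 : g = 0
        · simp [hg0]
        · rw [← card_filter]
          calc (Finset.univ.filter fun j : Fin n => g ≠ 0 ∧
                  ∃ t ∈ Set.Ioo (t₀ + h * (j : ℕ)) (t₀ + h * ((j : ℕ) + 1)), g.IsRoot t).card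
              ≤ (Finset.univ.filter fun j : Fin n =>
                  ∃ t ∈ Set.Ioo (t₀ + h * (j : ℕ)) (t₀ + h * ((j : ℕ) + 1)), g.IsRoot t).card := by
                refine card_le_card (fun j hj => ?_)
                rw [mem_filter] at hj ⊢
                exact ⟨hj.1, hj.2.2⟩
            _ ≤ g.natDegree := card_filter_exists_root_Ioo_le g hg0 t₀ hh n
            _ ≤ G.natDegree := natDegree_map_le
            _ ≤ d := hGd
    _ = d * n ^ m := by rw [sum_const, card_univ, card_baseIndex, smul_eq_mul, mul_comm]

end Literature.NumberTheory.Transcendental
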